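import Mathlib

/-!
# SoloBlind E53 — lifting a functional `T → ℤ/M` on a free ℤ-module to `T → ℤ`

Solo programme `solo-Langlands-blind`, own line (O1b), s118 (tower theory §13.9, claim C434(i): the easy direction of the q-expansion
depth certification).  The new Hecke ring `T` is a free ℤ-module of finite rank and `Hom_ℤ(T, ℤ) ≅ S(ℤ)` (forms with integral
q-expansion, `φ ↦ Σ φ(T_n) qⁿ`).  If `y^k` divides a cell modulus `M′ = #(T/I)`, the composite `T → T/I ≅ ℤ/M′ → ℤ/y^k` is additive,
and BECAUSE `T` IS FREE it lifts to some `φ : T → ℤ`, i.e. to a genuine integral cusp form whose coefficients are `≡ σ(n) (mod y^k)`: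
depth ≥ k.  The lifting step is `exists_lift`; `exists_lift_apply` is the pointwise form used in the argument.
-/

set_option linter.dupNamespace false

namespace Summit.Langlands.Langlands.Theorems.SoloBlindFreeLift

/-- Reduction mod `M` as a ℤ-linear map `ℤ → ZMod M`. -/
def redLinear (M : ℕ) : ℤ →ₗ[ℤ] ZMod M := (Int.castAddHom (ZMod M)).toIntLinearMap

/-- `redLinear M k = (k : ZMod M)`. -/
theorem redLinear_apply (M : ℕ) (k : ℤ) : redLinear M k = (k : ZMod M) := rfl

/-- Reduction mod `M` is surjective. -/
theorem redLinear_surjective (M : ℕ) : Function.Surjective (redLinear M) := by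
  intro x
  obtain ⟨k, hk⟩ := ZMod.intCast_surjective x
  exact ⟨k, hk⟩

/-- FREE LIFT: every ℤ-linear functional `T → ℤ/M` on a free ℤ-module `T` factors through a functional `T → ℤ`. -/
theorem exists_lift {T : Type*} [AddCommGroup T] [Module.Free ℤ T] (M : ℕ) (ψ : T →ₗ[ℤ] ZMod M) :
    ∃ φ : T →ₗ[ℤ] ℤ, (redLinear M).comp φ = ψ :=
  Module.projective_lifting_property (redLinear M) ψ (redLinear_surjective M)

/-- Pointwise form: the lift `φ` satisfies `φ t ≡ ψ t`, i.e. `(φ t : ZMod M) = ψ t` for every `t`. -/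
theorem exists_lift_apply {T : Type*} [AddCommGroup T] [Module.Free ℤ T] (M : ℕ) (ψ : T →ₗ[ℤ] ZMod M) :
    ∃ φ : T →ₗ[ℤ] ℤ, ∀ t : T, ((φ t : ℤ) : ZMod M) = ψ t := by
  obtain ⟨φ, hφ⟩ := exists_lift M ψ
  refine ⟨φ, fun t => ?_⟩
  have := LinearMap.congr_fun hφ t
  simpa [redLinear_apply] using this

/-- The same for an additive map (every additive map of abelian groups is ℤ-linear). -/
theorem exists_lift_addMonoidHom {T : Type*} [AddCommGroup T] [Module.Free ℤ T] (M : ℕ) (ψ : T →+ ZMod M) :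
    ∃ φ : T →+ ℤ, ∀ t : T, ((φ t : ℤ) : ZMod M) = ψ t := by
  obtain ⟨φ, hφ⟩ := exists_lift_apply M ψ.toIntLinearMap
  exact ⟨φ.toAddMonoidHom, fun t => by simpa using hφ t⟩

end Summit.Langlands.Langlands.Theorems.SoloBlindFreeLift
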